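import Summits.MatrixMultiplication.OmegaCensus.STPPSmallPatternT1K8OrderLawSeedsA
import Summits.MatrixMultiplication.OmegaCensus.STPPSmallPatternT1K8OrderLawSeedsB
import Summits.MatrixMultiplication.OmegaCensus.STPPSmallPatternT1K8OrderLawSeedsC
import Summits.MatrixMultiplication.OmegaCensus.STPPSmallPatternT1K8Orders48to51
import Summits.MatrixMultiplication.OmegaCensus.STPPElementaryTwoGroupSupplies
import Summits.MatrixMultiplication.OmegaCensus.STPPSmallPatternT1K8OrderLawCore
import Summits.MatrixMultiplication.OmegaCensus.STPPSmallPatternCyclicRaysT1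

/-!
# ω-census, small STPP pattern `(2,1,1)^k`: THE LAW «EVERY FINITE ABELIAN GROUP OF ORDER ≥ 48 HOSTS (2,1,1)⁸» (kernel)

Cell `pub-omega`, ω construction census, seat pub-omega ENG2 (gen 33). HONEST FRAMING (verbatim): lottery ticket; floor =
certified bounds/negative ranges.  Census STRUCTURE bookkeeping (column B5, `T1`, «above the onset, ORDER — not type — decides», here for
`k = 8`; same construction as `STPPSmallPatternT1K4OrderLaw.lean` / stpp-3's `STPPSmallPatternT2K4OrderLaw.lean`); nothing here bears on `ω`.

* `exists_isSTPP_211pow8_of_card_ge_48` — **every finite abelian group of order `≥ 48` admits an STPP family of size pattern `(2,1,1)⁸`.**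

Proof: exponent `≥ 48` ⇒ an element of order `≥ 48` ⇒ ENG2 gen 32's cyclic ray `exists_isSTPP_211pow8_of_addOrderOf`; exponent `E ≤ 45` ⇒
structure theorem, every prime-power factor divides `E`, the factor multiset capped by `capMS (capList E)` keeps product `≥ 48` (`prod_inter_ge48_8`),
and the kernel core `hostCore211K8_of_capped` shows it dominates one of the 60 MINIMAL seed types (`STPPSmallPatternT1K8OrderLawSeeds.lean`,
each with a decide witness); `exists_emb_of_dom` embeds the seed group and the witness is transported.  The two exponents beyond the tree's
capping table (`cap_spec` reaches `E ≤ 45`), `E = 46` (factors `2`, `23`; seeds `(ℤ/2)⁶`, `ℤ/23×(ℤ/2)²`, `(ℤ/23)²`) and `E = 47`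
(`(ℤ/47)²` embeds), are handled by two ad-hoc product forms.

References: H. Cohn, R. Kleinberg, B. Szegedy, C. Umans, FOCS 2005 (arXiv:math/0511460), Def. 5.1.  Seat pub-omega ENG2 (gen 33), 2026-08-28.
-/

open Literature.Computability.AlgebraicComplexity Finset

namespace Summit.MatrixMultiplication.OmegaCensus

/-! ## 1. The 60 minimal host seeds -/

/-- Every listed seed type hosts `(2,1,1)⁸` (kernel witnesses of `STPPSmallPatternT1K8OrderLawSeeds.lean`; `SeedType s` unfolds to the
witness's product type). [cite: CohnKleinbergSzegedyUmans2005, Def. 5.1] -/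
theorem exists_211pow8_of_mem_hostSeeds211K8 : ∀ s ∈ ([[3, 2, 2, 2, 2], [4, 3, 2, 2], [8, 3, 2], [4, 4, 3], [7, 7], [5, 5, 2], [13, 2, 2], [3, 3, 3, 2], [9, 3, 2], [7, 2, 2, 2], [7, 4, 2], [5, 3, 2, 2], [7, 3, 3], [2, 2, 2, 2, 2, 2], [4, 2, 2, 2, 2], [8, 2, 2, 2], [4, 4, 2, 2], [16, 2, 2], [8, 4, 2], [32, 2], [4, 4, 4], [16, 4], [8, 8], [17, 2, 2], [3, 3, 2, 2, 2], [9, 2, 2, 2], [4, 3, 3, 2], [9, 4, 2], [8, 3, 3], [5, 5, 3], [19, 2, 2], [5, 2, 2, 2, 2], [5, 4, 2, 2], [8, 5, 2], [5, 4, 4], [3, 3, 3, 3], [9, 3, 3], [27, 3], [9, 9], [7, 3, 2, 2], [11, 2, 2, 2], [11, 4, 2], [5, 3, 3, 2], [11, 3, 3], [13, 3, 3], [11, 11], [5, 5, 5], [25, 5], [5, 3, 3, 3], [9, 5, 3], [13, 13], [7, 5, 5], [17, 17], [19, 19], [23, 23], [29, 29], [31, 31], [37, 37], [41, 41], [43,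 43]] : List (List ℕ)),
    ∃ A B C : Fin 8 → Finset (SeedType s), IsSTPP A B C ∧ ∀ i, (A i).card = 2 ∧ (B i).card = 1 ∧ (C i).card = 1 := by
  intro s hs
  simp only [List.mem_cons, List.mem_nil_iff, or_false] at hs
  rcases hs with rfl | rfl | rfl | rfl | rfl | rfl | rfl | rfl | rfl | rfl | rfl | rfl | rfl | rfl | rfl | rfl | rfl | rfl | rfl | rfl | rfl | rfl | rfl | rfl | rfl | rfl | rfl | rfl | rfl | rfl | rfl | rfl | rfl | rfl | rfl | rfl | rfl | rfl | rfl | rfl | rfl | rfl | rfl | rfl | rfl | rfl | rfl | rfl | rfl | rfl | rfl | rfl | rfl | rfl | rfl | rfl | rfl | rfl | rfl | rfl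
  · exact exists_isSTPP_211pow8_seed_3_2_2_2_2
  · exact exists_isSTPP_211pow8_seed_4_3_2_2
  · exact exists_isSTPP_211pow8_seed_8_3_2
  · exact exists_isSTPP_211pow8_seed_4_4_3
  · exact exists_isSTPP_211pow8_seed_7_7
  · exact exists_isSTPP_211pow8_seed_5_5_2
  · exact exists_isSTPP_211pow8_seed_13_2_2
  · exact exists_isSTPP_211pow8_seed_3_3_3_2
  · exact exists_isSTPP_211pow8_seed_9_3_2
  · exact exists_isSTPP_211pow8_seed_7_2_2_2
  · exact exists_isSTPP_211pow8_seed_7_4_2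
  · exact exists_isSTPP_211pow8_seed_5_3_2_2
  · exact exists_isSTPP_211pow8_seed_7_3_3
  · exact exists_isSTPP_211pow8_zmod2pow6
  · exact exists_isSTPP_211pow8_seed_4_2_2_2_2
  · exact exists_isSTPP_211pow8_seed_8_2_2_2
  · exact exists_isSTPP_211pow8_seed_4_4_2_2
  · exact exists_isSTPP_211pow8_seed_16_2_2
  · exact exists_isSTPP_211pow8_seed_8_4_2
  · exact exists_isSTPP_211pow8_seed_32_2
  · exact exists_isSTPP_211pow8_seed_4_4_4
  · exact exists_isSTPP_211pow8_seed_16_4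
  · exact exists_isSTPP_211pow8_seed_8_8
  · exact exists_isSTPP_211pow8_seed_17_2_2
  · exact exists_isSTPP_211pow8_seed_3_3_2_2_2
  · exact exists_isSTPP_211pow8_seed_9_2_2_2
  · exact exists_isSTPP_211pow8_seed_4_3_3_2
  · exact exists_isSTPP_211pow8_seed_9_4_2
  · exact exists_isSTPP_211pow8_seed_8_3_3
  · exact exists_isSTPP_211pow8_seed_5_5_3
  · exact exists_isSTPP_211pow8_seed_19_2_2
  · exact exists_isSTPP_211pow8_seed_5_2_2_2_2
  · exact exists_isSTPP_211pow8_seed_5_4_2_2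
  · exact exists_isSTPP_211pow8_seed_8_5_2
  · exact exists_isSTPP_211pow8_seed_5_4_4
  · exact exists_isSTPP_211pow8_seed_3_3_3_3
  · exact exists_isSTPP_211pow8_seed_9_3_3
  · exact exists_isSTPP_211pow8_seed_27_3
  · exact exists_isSTPP_211pow8_seed_9_9
  · exact exists_isSTPP_211pow8_seed_7_3_2_2
  · exact exists_isSTPP_211pow8_seed_11_2_2_2
  · exact exists_isSTPP_211pow8_seed_11_4_2
  · exact exists_isSTPP_211pow8_seed_5_3_3_2
  · exact exists_isSTPP_211pow8_seed_11_3_3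
  · exact exists_isSTPP_211pow8_seed_13_3_3
  · exact exists_isSTPP_211pow8_seed_11_11
  · exact exists_isSTPP_211pow8_seed_5_5_5
  · exact exists_isSTPP_211pow8_seed_25_5
  · exact exists_isSTPP_211pow8_seed_5_3_3_3
  · exact exists_isSTPP_211pow8_seed_9_5_3
  · exact exists_isSTPP_211pow8_seed_13_13
  · exact exists_isSTPP_211pow8_seed_7_5_5
  · exact exists_isSTPP_211pow8_seed_17_17
  · exact exists_isSTPP_211pow8_seed_19_19
  · exact exists_isSTPP_211pow8_seed_23_23
  · exact exists_isSTPP_211pow8_seed_29_29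
  · exact exists_isSTPP_211pow8_seed_31_31
  · exact exists_isSTPP_211pow8_seed_37_37
  · exact exists_isSTPP_211pow8_seed_41_41
  · exact exists_isSTPP_211pow8_seed_43_43

/-! ## 2. The capping step at threshold 48 -/

/-- If every element `a` of `M` satisfies `48 ≤ a ^ count a C` and `1 ≤ a`, and `48 ≤ M.prod`, then `M ∩ C` still has product `≥ 48`
(`prod_inter_ge` of `STPP222CubeFrom46.lean` at threshold `48`). -/
theorem prod_inter_ge48_8 {M C : Multiset ℕ} (hM : 48 ≤ M.prod) (hpos : ∀ a ∈ M, 1 ≤ a)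
    (hcap : ∀ a ∈ M, 48 ≤ a ^ Multiset.count a C) : 48 ≤ (M ∩ C).prod := by
  by_cases hle : M ≤ C
  · have : M ∩ C = M := le_antisymm Multiset.inter_le_left (Multiset.le_inter le_rfl hle)
    rw [this]; exact hM
  · rw [Multiset.le_iff_count] at hle
    push Not at hle
    obtain ⟨a, ha⟩ := hle
    have haM : a ∈ M := Multiset.count_pos.1 (by omega)
    have hcnt : Multiset.count a (M ∩ C) = Multiset.count a C := by
      rw [Multiset.count_inter]; omega
    have hrep : Multiset.replicate (Multiset.count a C) a ≤ M ∩ C :=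
      Multiset.le_count_iff_replicate_le.1 hcnt.ge
    obtain ⟨R, hR⟩ := Multiset.le_iff_exists_add.1 hrep
    have hRpos : ∀ x ∈ R, 1 ≤ x := fun x hx =>
      hpos x (Multiset.mem_of_le Multiset.inter_le_left (hR ▸ Multiset.mem_add.2 (Or.inr hx)))
    have h1 : 1 ≤ R.prod := Multiset.one_le_prod_of_one_le hRpos
    rw [hR, Multiset.prod_add, Multiset.prod_replicate]
    calc 48 ≤ a ^ Multiset.count a C := hcap a haM
      _ = a ^ Multiset.count a C * 1 := (mul_one _).symm
      _ ≤ a ^ Multiset.count a C * R.prod := Nat.mul_le_mul_left _ h1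

/-- The caps are large enough for threshold `48`: `v ^ (multiplicity of v in C_E) ≥ 48` for every prime power `v ≤ 45` dividing `E`,
`1 ≤ E ≤ 45` (kernel decision; the tree's `cap_spec` states `≥ 46`). -/
theorem cap_spec48 : ∀ E ∈ List.range' 1 45, ∀ v ∈ ppList, v ∣ E →
    48 ≤ v ^ Multiset.count v (capMS (capList E)) := by
  decide +kernel

/-- Domination for an arbitrary multiset of prime powers from `ppList`, all dividing some `1 ≤ E ≤ 45`, with product `≥ 48`. -/
theorem exists_hostSeed211K8_dom {M : Multiset ℕ} {E : ℕ} (hE1 : 1 ≤ E) (hEmax : E ≤ 45)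
    (hpp : ∀ a ∈ M, a ∈ ppList) (hdvd : ∀ a ∈ M, a ∣ E) (hprod : 48 ≤ M.prod) :
    ∃ s ∈ ([[3, 2, 2, 2, 2], [4, 3, 2, 2], [8, 3, 2], [4, 4, 3], [7, 7], [5, 5, 2], [13, 2, 2], [3, 3, 3, 2], [9, 3, 2], [7, 2, 2, 2], [7, 4, 2], [5, 3, 2, 2], [7, 3, 3], [2, 2, 2, 2, 2, 2], [4, 2, 2, 2, 2], [8, 2, 2, 2], [4, 4, 2, 2], [16, 2, 2], [8, 4, 2], [32, 2], [4, 4, 4], [16, 4], [8, 8], [17, 2, 2], [3, 3, 2, 2, 2], [9, 2, 2, 2], [4, 3, 3, 2], [9, 4, 2], [8, 3, 3], [5, 5, 3], [19, 2, 2], [5, 2, 2, 2, 2], [5, 4, 2, 2], [8, 5, 2], [5, 4, 4], [3, 3, 3, 3], [9, 3, 3], [27, 3], [9, 9], [7, 3, 2, 2], [11, 2, 2, 2], [11, 4, 2], [5, 3, 3, 2], [11, 3, 3], [13, 3, 3], [11, 11], [5, 5, 5], [25, 5], [5, 3, 3, 3], [9, 5, 3], [13, 13], [7, 5, 5], [17,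 17], [19, 19], [23, 23], [29, 29], [31, 31], [37, 37], [41, 41], [43, 43]] : List (List ℕ)), dom s M = true := by
  have hEI : E ∈ List.range' 1 45 := List.mem_range'_1.2 ⟨hE1, by omega⟩
  have hEI45 : E ∈ List.range' 1 45 := List.mem_range'_1.2 ⟨hE1, by omega⟩
  set C := capMS (capList E) with hC
  have hcapd := prod_inter_ge48_8 (C := C) hprod (fun a ha => one_le_of_mem_ppList (hpp a ha))
    (fun a ha => cap_spec48 E hEI45 a (hpp a ha) (hdvd a ha))
  have hmem : M ∩ C ∈ subMS (capList E) := mem_subMS_of_le _ _ Multiset.inter_le_right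
  obtain ⟨s, hs, hD⟩ := hostCore211K8_of_capped E hEI (M ∩ C) hmem hcapd
  exact ⟨s, hs, dom_mono s Multiset.inter_le_left hD⟩

/-! ## 3. The law -/

/-- The product form: `Π i, ℤ/pᵢ^eᵢ` admits `(2,1,1)⁸` as soon as every `pᵢ^eᵢ` divides some `1 ≤ E ≤ 45` and `∏ pᵢ^eᵢ ≥ 48`.
[cite: CohnKleinbergSzegedyUmans2005, Def. 5.1] -/
theorem exists_isSTPP_211pow8_pi {ι : Type} [Fintype ι] [DecidableEq ι] (p e : ι → ℕ)
    (hp : ∀ i, (p i).Prime) {E : ℕ} (hE1 : 1 ≤ E) (hEmax : E ≤ 45) (hdvd : ∀ i, p i ^ e i ∣ E)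
    (hcard : 48 ≤ ∏ i, p i ^ e i) :
    ∃ A B C : Fin 8 → Finset (Π i, ZMod (p i ^ e i)), IsSTPP A B C ∧
      ∀ i, (A i).card = 2 ∧ (B i).card = 1 ∧ (C i).card = 1 := by
  have hq0 : ∀ i, p i ^ e i ≠ 0 := fun i => pow_ne_zero _ (hp i).ne_zero
  have hprod : 48 ≤ ((Finset.univ.filter fun i => 0 < e i).val.map fun i => p i ^ e i).prod := by
    have : ((Finset.univ.filter fun i => 0 < e i).val.map fun i => p i ^ e i).prod = ∏ i, p i ^ e i := by
      rw [← Finset.prod_eq_multiset_prod]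
      exact Finset.prod_filter_of_ne fun i _ hi => Nat.pos_of_ne_zero fun h0 => hi (by rw [h0, pow_zero])
    rw [this]; exact hcard
  have hmem : ∀ a ∈ ((Finset.univ.filter fun i => 0 < e i).val.map fun i => p i ^ e i),
      a ∈ ppList ∧ a ∣ E := by
    intro a ha
    obtain ⟨i, hi, rfl⟩ := Multiset.mem_map.1 ha
    have hi' : 0 < e i := (Finset.mem_filter.1 hi).2
    exact ⟨pow_mem_ppList (hp i) hi' (le_trans (Nat.le_of_dvd (by omega) (hdvd i)) (by omega)), hdvd i⟩
  obtain ⟨s, hs, hD⟩ :=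
    exists_hostSeed211K8_dom hE1 hEmax (fun a ha => (hmem a ha).1) (fun a ha => (hmem a ha).2) hprod
  obtain ⟨φ, hφ, -⟩ := exists_emb_of_dom (fun i => p i ^ e i) hq0 s _ hD
  exact exists_isSTPP_211_of_injective φ hφ (exists_211pow8_of_mem_hostSeeds211K8 s hs)

/-! ## 3b. The two exponents beyond the capping table: `E = 46` and `E = 47` -/

/-- Seeds for exponent `46` (factors `2`, `23` only): every capped multiset of product `≥ 48` dominates `(ℤ/2)⁶`, `ℤ/23×(ℤ/2)²` or `(ℤ/23)²`. -/
theorem hostCore211K8_E46 : ∀ M ∈ subMS (capList 46), 48 ≤ M.prod →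
    ∃ s ∈ ([[2, 2, 2, 2, 2, 2], [23, 2, 2], [23, 23]] : List (List ℕ)), dom s M = true := by
  decide +kernel

/-- The three exponent-46 seed types host `(2,1,1)⁸`. [cite: CohnKleinbergSzegedyUmans2005, Def. 5.1] -/
theorem exists_211pow8_of_mem_hostSeeds211K8_E46 : ∀ s ∈ ([[2, 2, 2, 2, 2, 2], [23, 2, 2], [23, 23]] : List (List ℕ)),
    ∃ A B C : Fin 8 → Finset (SeedType s), IsSTPP A B C ∧ ∀ i, (A i).card = 2 ∧ (B i).card = 1 ∧ (C i).card = 1 := by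
  intro s hs
  simp only [List.mem_cons, List.mem_nil_iff, or_false] at hs
  rcases hs with rfl | rfl | rfl
  · exact exists_isSTPP_211pow8_zmod2pow6
  · exact exists_isSTPP_211pow8_seed_23_2_2
  · exact exists_isSTPP_211pow8_seed_23_23

/-- Product form at exponent `46`: the prime-power factors are `2` or `23`; capping by `capMS (capList 46)` (six `2`s, two `23`s) keeps product `≥ 48`.
[cite: CohnKleinbergSzegedyUmans2005, Def. 5.1] -/
theorem exists_isSTPP_211pow8_pi46 {ι : Type} [Fintype ι] [DecidableEq ι] (p e : ι → ℕ)
    (hp : ∀ i, (p i).Prime) (hdvd : ∀ i, p i ^ e i ∣ 46) (hcard : 48 ≤ ∏ i, p i ^ e i) :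
    ∃ A B C : Fin 8 → Finset (Π i, ZMod (p i ^ e i)), IsSTPP A B C ∧
      ∀ i, (A i).card = 2 ∧ (B i).card = 1 ∧ (C i).card = 1 := by
  have hq0 : ∀ i, p i ^ e i ≠ 0 := fun i => pow_ne_zero _ (hp i).ne_zero
  set M : Multiset ℕ := (Finset.univ.filter fun i => 0 < e i).val.map fun i => p i ^ e i with hMdef
  have hprod : 48 ≤ M.prod := by
    have : M.prod = ∏ i, p i ^ e i := by
      rw [hMdef, ← Finset.prod_eq_multiset_prod]
      exact Finset.prod_filter_of_ne fun i _ hi => Nat.pos_of_ne_zero fun h0 => hi (by rw [h0, pow_zero])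
    rw [this]; exact hcard
  have hmem : ∀ a ∈ M, a = 2 ∨ a = 23 := by
    intro a ha
    rw [hMdef] at ha
    obtain ⟨i, hi, rfl⟩ := Multiset.mem_map.1 ha
    have hi' : 0 < e i := (Finset.mem_filter.1 hi).2
    have hpd : p i ∣ 46 := (dvd_pow_self (p i) hi'.ne').trans (hdvd i)
    have hp2 : p i = 2 ∨ p i = 23 := by
      rcases (Nat.Prime.dvd_mul (hp i)).1 (show p i ∣ 2 * 23 from hpd) with h | h
      · exact Or.inl ((Nat.prime_dvd_prime_iff_eq (hp i) Nat.prime_two).1 h)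
      · exact Or.inr ((Nat.prime_dvd_prime_iff_eq (hp i) (by norm_num)).1 h)
    have he : e i = 1 := by
      by_contra hne
      have h2 : 2 ≤ e i := by omega
      have hsq : p i ^ 2 ∣ 46 := (pow_dvd_pow (p i) h2).trans (hdvd i)
      rcases hp2 with h | h <;> rw [h] at hsq <;> revert hsq <;> decide
    rcases hp2 with h | h
    · exact Or.inl (by rw [h, he]; norm_num)
    · exact Or.inr (by rw [h, he]; norm_num)
  set C := capMS (capList 46) with hC
  have hcnt2 : Multiset.count 2 (capMS (capList 46)) = 6 := by decide
  have hcnt23 : Multiset.count 23 (capMS (capList 46)) = 2 := by decide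
  have hcapd := prod_inter_ge48_8 (C := C) hprod (fun a ha => by rcases hmem a ha with rfl | rfl <;> norm_num)
    (fun a ha => by
      rcases hmem a ha with rfl | rfl
      · rw [hC, hcnt2]; norm_num
      · rw [hC, hcnt23]; norm_num)
  have hsub : M ∩ C ∈ subMS (capList 46) := mem_subMS_of_le _ _ Multiset.inter_le_right
  obtain ⟨s, hs, hD⟩ := hostCore211K8_E46 (M ∩ C) hsub hcapd
  obtain ⟨φ, hφ, -⟩ := exists_emb_of_dom (fun i => p i ^ e i) hq0 s _ (dom_mono s Multiset.inter_le_left hD)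
  exact exists_isSTPP_211_of_injective φ hφ (exists_211pow8_of_mem_hostSeeds211K8_E46 s hs)

/-- Product form at exponent `47`: every non-trivial factor is `ℤ/47`, and there are at least two (product `≥ 48`), so `(ℤ/47)²` embeds.
[cite: CohnKleinbergSzegedyUmans2005, Def. 5.1] -/
theorem exists_isSTPP_211pow8_pi47 {ι : Type} [Fintype ι] [DecidableEq ι] (p e : ι → ℕ)
    (hp : ∀ i, (p i).Prime) (hdvd : ∀ i, p i ^ e i ∣ 47) (hcard : 48 ≤ ∏ i, p i ^ e i) :
    ∃ A B C : Fin 8 → Finset (Π i, ZMod (p i ^ e i)), IsSTPP A B C ∧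
      ∀ i, (A i).card = 2 ∧ (B i).card = 1 ∧ (C i).card = 1 := by
  have hq0 : ∀ i, p i ^ e i ≠ 0 := fun i => pow_ne_zero _ (hp i).ne_zero
  set M : Multiset ℕ := (Finset.univ.filter fun i => 0 < e i).val.map fun i => p i ^ e i with hMdef
  have hprod : 48 ≤ M.prod := by
    have : M.prod = ∏ i, p i ^ e i := by
      rw [hMdef, ← Finset.prod_eq_multiset_prod]
      exact Finset.prod_filter_of_ne fun i _ hi => Nat.pos_of_ne_zero fun h0 => hi (by rw [h0, pow_zero])
    rw [this]; exact hcard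
  have hall : ∀ a ∈ M, a = 47 := by
    intro a ha
    rw [hMdef] at ha
    obtain ⟨i, hi, rfl⟩ := Multiset.mem_map.1 ha
    have hi' : 0 < e i := (Finset.mem_filter.1 hi).2
    rcases (Nat.dvd_prime (by norm_num : Nat.Prime 47)).1 (hdvd i) with h1 | h47
    · exact absurd h1 (Nat.one_lt_pow hi'.ne' (hp i).one_lt).ne'
    · exact h47
  set n := Multiset.card M with hn
  have hM : M = Multiset.replicate n 47 := Multiset.eq_replicate.2 ⟨rfl, hall⟩
  have hn2 : 2 ≤ n := by
    by_contra hlt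
    have hle : M.prod ≤ 47 := by
      rw [hM, Multiset.prod_replicate]
      calc 47 ^ n ≤ 47 ^ 1 := Nat.pow_le_pow_right (by norm_num) (by omega)
        _ = 47 := by norm_num
    omega
  have hdom : dom [47, 47] M = true := by
    refine dom_mono [47, 47] (M' := Multiset.replicate 2 47) ?_ (by decide)
    rw [hM]
    exact (Multiset.replicate_le_replicate 47).2 hn2
  obtain ⟨φ, hφ, -⟩ := exists_emb_of_dom (fun i => p i ^ e i) hq0 [47, 47] _ hdom
  exact exists_isSTPP_211_of_injective φ hφ exists_isSTPP_211pow8_seed_47_47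

/-- **THE LAW: every finite abelian group of order `≥ 48` admits an STPP family of size pattern `(2,1,1)⁸`** (CKSU Def. 5.1, tree `IsSTPP`).
Exponent `≥ 48`: the cyclic ray; exponent `≤ 45`: structure theorem + kernel-decided domination of one of 60 minimal seed types + generic
embedding; exponents `46`, `47`: the two ad-hoc product forms above.  No `ω` bound follows. [cite: CohnKleinbergSzegedyUmans2005, Def. 5.1] -/
theorem exists_isSTPP_211pow8_of_card_ge_48 {G : Type*} [AddCommGroup G] [Finite G] (hG : 48 ≤ Nat.card G) :
    ∃ A B C : Fin 8 → Finset G, IsSTPP A B C ∧ ∀ i, (A i).card = 2 ∧ (B i).card = 1 ∧ (C i).card = 1 := by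
  classical
  by_cases hexp : 48 ≤ AddMonoid.exponent G
  · obtain ⟨g, hg⟩ := AddMonoid.exists_addOrderOf_eq_exponent (AddMonoid.ExponentExists.of_finite (G := G))
    exact exists_isSTPP_211pow8_of_addOrderOf_ge48 g (by rw [hg]; exact hexp)
  obtain ⟨ι, _, p, hp, e, ⟨g⟩⟩ := AddCommGroup.equiv_directSum_zmod_of_finite G
  let f : G ≃+ (Π i, ZMod (p i ^ e i)) :=
    g.trans (DirectSum.linearEquivFunOnFintype ℕ ι (fun i => ZMod (p i ^ e i))).toAddEquiv
  have hE1 : 1 ≤ AddMonoid.exponent G := Nat.pos_of_ne_zero AddMonoid.exponent_ne_zero_of_finite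
  have hdvd : ∀ i, p i ^ e i ∣ AddMonoid.exponent G := fun i => by
    have hinj : Function.Injective (AddMonoidHom.single (fun j => ZMod (p j ^ e j)) i) :=
      Pi.single_injective (M := fun j => ZMod (p j ^ e j)) i
    have h1 : addOrderOf (f.symm (AddMonoidHom.single (fun j => ZMod (p j ^ e j)) i 1)) = p i ^ e i := by
      rw [AddEquiv.addOrderOf_eq, addOrderOf_injective _ hinj, ZMod.addOrderOf_one]
    rw [← h1]
    exact AddMonoid.addOrder_dvd_exponent _
  have hcard : 48 ≤ ∏ i, p i ^ e i := by
    have : Nat.card G = ∏ i, p i ^ e i := by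
      rw [Nat.card_congr f.toEquiv, Nat.card_pi]
      simp [Nat.card_zmod]
    rw [← this]; exact hG
  by_cases h47 : AddMonoid.exponent G = 47
  · have h := exists_isSTPP_211pow8_pi47 p e hp (fun i => h47 ▸ hdvd i) hcard
    exact exists_isSTPP_211_of_injective f.symm.toAddMonoidHom f.symm.injective h
  by_cases h46 : AddMonoid.exponent G = 46
  · have h := exists_isSTPP_211pow8_pi46 p e hp (fun i => h46 ▸ hdvd i) hcard
    exact exists_isSTPP_211_of_injective f.symm.toAddMonoidHom f.symm.injective h
  have h := exists_isSTPP_211pow8_pi p e hp hE1 (by omega) hdvd hcard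
  exact exists_isSTPP_211_of_injective f.symm.toAddMonoidHom f.symm.injective h

end Summit.MatrixMultiplication.OmegaCensus
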